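import Literature.IUT.HodgeTheaters.FPrimeStripsRigidity
import Literature.AnabelianGeometry.AbsoluteAnabelian.MonoidKummerMapsIdRigidProofs
import HarnessLib

/-!
# [IUTchI] Corollary 5.3 (ii), nonarchimedean model case, INJECTIVITY HALF in `FKit` currency from
# [AbsTopIII] Proposition 3.2 (iv) — proof-only (L5 HUB row «C53ii/N1 PAIR-RIGIDITY-TO-FKIT-INJ»)

S. Mochizuki, *Inter-universal Teichmüller theory I*, kurims manuscript (May 2020), §5, Corollary 5.3 (ii)
p. 144 l. 14–18 («the natural map `Isom(¹𝔉, ²𝔉) → Isom(¹𝔇, ²𝔇)` is bijective»), proof p. 144 l. 36–39: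
«Assertion (ii) … follows immediately from [AbsTopIII], Proposition 3.2, (iv); [AbsTopIII], Proposition 4.2,
(i) [cf. also [AbsTopIII], Remarks 3.1.1, 4.1.1; the discussion of Definition 5.2, (vi), (viii), of the present
paper]» ([IUTchI] Cor 5.3 (ii) p.144) [claim: Mochizuki2012, status: disputed] — cone node `IUTchI:Cor5.3(ii)`,
sub-DAG row C53ii/L04 clause (b) of HOME/plan …/SUBDAG-IUTchI-Cor53.md (abc-iut-L5-t4), discharger row
«C53ii/N1» (holder abc-iut-w5-d175).  S. Mochizuki, *Topics in absolute anabelian geometry III*, Prop. 3.2 (iv)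
p. 72: «the natural functor of Definition 3.1, (iii), induces an injection
`Isom((Π ↷ M_T), (Π* ↷ M*_T)) ↪ Isom_TG(Π, Π*)`» [cite: MochizukiAbsTopIII2015, Proposition 3.2 (iv) p.72] —
PROVED in the tree for `T = TM` as `pairIsoDeterminedByGalois_holds` (abc-iut-L6-t13, `MonoidKummerMapsProofs`).

WHAT IS PROVED HERE (theorems only; no `def`, no `instance`; nothing of the series asserted).  abc-iut-L5-t4's
`PMBaseKit.FKit` types the `ℱ`-prime-strip slots abstractly (`FAmb v`, `fModel v`, `toD v : FAmb v ⥤ Amb v`), and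
`isomFtoDBijective_iff_model` (p409092) reduces Cor 5.3 (ii) to the MODEL CASE
`Function.Bijective fun α : ℱ_v ≅ ℱ_v => (toD v).mapIso α` at each `v`.  For a nonarchimedean slot whose objects
are (isomorphs of) MLF-Galois `TM`-pairs `(Π_v ↷ 𝒪^⊳)` of [AbsTopIII] Def. 3.1 (abc-iut-L4-t2's category
`GaloisMonoidPair`, presented by any FAITHFUL functor `ι : FAmb v ⥤ GaloisMonoidPair`) and whose base functor
`toD v` READS THE GALOIS COMPONENT (two morphisms with the same image under `toD v` have the same `Π`-component —
the only property of «`ℱ_v ↦ 𝒟_v` = `(Π ↷ M) ↦ Π`» that the injectivity argument uses; the target category is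
arbitrary), the INJECTIVITY HALF of the model case holds:

* pair-category level: `Cor53ii.catIso_eq_of_homPi_eq` (an isomorphism of pairs in the category of
  Def. 3.1 (iii) is determined by its Galois component, from the rigidity statement for that pair of objects),
  `…_of_isTM` (unconditional for MLF-Galois `TM`-pairs, from `pairIsoDeterminedByGalois_holds` BY NAME),
  `Cor53ii.homPi_injective_of_isTM`;
* functor level: `Cor53ii.mapIso_injective_of_readsGalois(_of_isTM)` — for `ι : C ⥤ GaloisMonoidPair` faithful and
  `G : C ⥤ D` reading the Galois component, `α ↦ G.mapIso α` is injective on `X ≅ Y` (`TM`-pairs);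
  full-subcategory form `Cor53ii.mapIso_injective_fullSubcategory_TM` over L4-t2's `MLFGaloisMonoidPairCat .TM`;
* the INNER-AUTOMORPHISM form needed when the base records only OUTER isomorphisms of `Π` (the §0 convention
  «a morphism of categories is an isomorphism class of functors»; cf. row C53ii/N2): two isomorphisms of `TM`-pairs
  whose Galois components differ by `Inn(q)` differ by the inner pair automorphism `GaloisMonoidPair.Iso.conj`
  (`Cor53ii.isoM_eq_smul_of_isoPi_eq_conj`, `Cor53ii.catIso_eq_trans_conj_of_homPi_eq_conj`);
* `FKit` currency: `PMBaseKit.FKit.model_injective_of_readsGalois` = the injectivity half of the hypothesis `h v`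
  of `isomFtoDBijective_of_model` at such a slot; and the injectivity halves of abc-iut-L5-t4's transport lemmas,
  `FKit.mapIso_injective_of_model` (model object ⇒ arbitrary isomorphs) and `FKit.assocDMap_injective_of_model`
  (⇒ `Isom(¹𝔉, ²𝔉) → Isom(¹𝔇, ²𝔇)` injective for all `ℱ`-prime-strips), so that the injectivity half of the token can
  be booked place-type by place-type.

NOT touched: the surjectivity half (print: [AbsTopIII] Prop. 3.2 (iv) bijectivity for pairs of hyperbolic
orbicurve type = L4-t2's schema `GaloisIsoLiftsToTMPairIso H`, instance `…_of_openAug_holds` p432154 — consumed BY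
NAME by whoever assembles the bijective model case); the archimedean third ([AbsTopIII] Prop. 4.2 (i)); the
genuine kit.  HONEST FRAMING: elementary category-theoretic bookkeeping over OUR typed interfaces plus one refereed
2015 statement already kernel-checked in the tree; no side taken on [IUTchIII] Cor. 3.12; nothing here asserts abc
proved or refuted; typed ≠ proved for the interfaces themselves.
-/

namespace Literature.IUT.HodgeTheaters

open CategoryTheory
open Literature.AnabelianGeometry.AbsoluteAnabelian

universe v₁ u₁ v₂ u₂ u

namespace Cor53ii

/-! ### Pair-category level: an isomorphism of `TM`-pairs is determined by its Galois component -/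

/-- In abc-iut-L4-t2's category of pairs `(Π ↷ M)` ([AbsTopIII] Def. 3.1 (iii)), an isomorphism `a : P ≅ Q` is
determined by its Galois component `a.hom.homPi : Π → Π*` as soon as the rigidity statement of Prop. 3.2 (iv)
holds for the pair of objects `P, Q` (hypothesis `hrig`, in L4-t2's `GaloisMonoidPair.Iso` currency; for MLF-Galois
`TM`-pairs it is the tree theorem `pairIsoDeterminedByGalois_holds`, see `catIso_eq_of_homPi_eq_of_isTM`).
([IUTchI] Cor 5.3 (ii) p.144) [claim: Mochizuki2012, status: disputed] -/
theorem catIso_eq_of_homPi_eq {P Q : GaloisMonoidPair.{u}}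
    (hrig : ∀ e₁ e₂ : GaloisMonoidPair.Iso P Q, e₁.isoPi = e₂.isoPi → e₁.isoM = e₂.isoM)
    {a₁ a₂ : P ≅ Q} (h : a₁.hom.homPi = a₂.hom.homPi) : a₁ = a₂ := by
  have hPi : (GaloisMonoidPair.isoOfCatIso a₁).isoPi = (GaloisMonoidPair.isoOfCatIso a₂).isoPi :=
    ContinuousMulEquiv.ext fun g => by
      rw [GaloisMonoidPair.isoOfCatIso_isoPi_apply, GaloisMonoidPair.isoOfCatIso_isoPi_apply, h]
  have hM := hrig _ _ hPi
  refine Iso.ext (GaloisMonoidPair.Hom.ext h (MonoidHom.ext fun x => ?_))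
  have hx := MulEquiv.congr_fun hM x
  rwa [GaloisMonoidPair.isoOfCatIso_isoM_apply, GaloisMonoidPair.isoOfCatIso_isoM_apply] at hx

/-- **[AbsTopIII] Prop. 3.2 (iv), injectivity, in the CATEGORY of pairs**: for MLF-Galois `TM`-pairs `P, Q` an
isomorphism `P ≅ Q` in the category of [AbsTopIII] Def. 3.1 (iii) is determined by its Galois component —
unconditionally, from abc-iut-L6-t13's `pairIsoDeterminedByGalois_holds` (consumed BY NAME).
[cite: MochizukiAbsTopIII2015, Proposition 3.2 (iv) p.72] -/
theorem catIso_eq_of_homPi_eq_of_isTM {P Q : GaloisMonoidPair.{0}}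
    (hP : IsMLFGaloisMonoidPair .TM P) (hQ : IsMLFGaloisMonoidPair .TM Q)
    {a₁ a₂ : P ≅ Q} (h : a₁.hom.homPi = a₂.hom.homPi) : a₁ = a₂ :=
  catIso_eq_of_homPi_eq (pairIsoDeterminedByGalois_holds P Q hP hQ) h

/-- The same, as the injectivity of `Isom(P, Q) → Hom_TG(Π, Π*)`, `a ↦ a_Π`, for MLF-Galois `TM`-pairs («induces
an injection `Isom((Π ↷ M_T), (Π* ↷ M*_T)) ↪ Isom_TG(Π, Π*)`»).
[cite: MochizukiAbsTopIII2015, Proposition 3.2 (iv) p.72] -/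
theorem homPi_injective_of_isTM {P Q : GaloisMonoidPair.{0}}
    (hP : IsMLFGaloisMonoidPair .TM P) (hQ : IsMLFGaloisMonoidPair .TM Q) :
    Function.Injective fun a : P ≅ Q => a.hom.homPi :=
  fun _ _ h => catIso_eq_of_homPi_eq_of_isTM hP hQ h

/-! ### Functor level: a base functor that READS the Galois component is injective on isomorphisms -/

/-- **Cor 5.3 (ii), nonarchimedean model case, injectivity — functor form.**  Let `C` be any category of
(isomorphs of) pairs, presented by a faithful functor `ι : C ⥤ GaloisMonoidPair`, and `G : C ⥤ D` any functor
that READS THE GALOIS COMPONENT (`hG`: morphisms with the same image under `G` have the same `Π`-component under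
`ι`) — the shape of `ℱ_v ↦ 𝒟_v`, `(Π_v ↷ 𝒪^⊳) ↦ Π_v` (Rmk 5.2.1 (i); [AbsTopIII] Def. 3.1 (iii) «natural functor»).
If the rigidity statement of [AbsTopIII] Prop. 3.2 (iv) holds for `ι X, ι Y`, then `α ↦ G.mapIso α` is injective
on `X ≅ Y`. ([IUTchI] Cor 5.3 (ii) p.144) [claim: Mochizuki2012, status: disputed] -/
theorem mapIso_injective_of_readsGalois
    {C : Type u₁} [Category.{v₁} C] {D : Type u₂} [Category.{v₂} D]
    (ι : C ⥤ GaloisMonoidPair.{u}) [ι.Faithful] (G : C ⥤ D)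
    (hG : ∀ {X Y : C} (f g : X ⟶ Y), G.map f = G.map g → (ι.map f).homPi = (ι.map g).homPi)
    {X Y : C}
    (hrig : ∀ e₁ e₂ : GaloisMonoidPair.Iso (ι.obj X) (ι.obj Y), e₁.isoPi = e₂.isoPi → e₁.isoM = e₂.isoM) :
    Function.Injective fun α : X ≅ Y => G.mapIso α := by
  intro α₁ α₂ hα
  have h1 : G.map α₁.hom = G.map α₂.hom := congrArg Iso.hom hα
  have h3 : ι.mapIso α₁ = ι.mapIso α₂ := catIso_eq_of_homPi_eq hrig (hG _ _ h1)
  exact Iso.ext (ι.map_injective (congrArg Iso.hom h3))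

/-- **Cor 5.3 (ii), nonarchimedean model case, injectivity — functor form, unconditional for `TM`-pairs**: as
`mapIso_injective_of_readsGalois`, with the rigidity input supplied by `pairIsoDeterminedByGalois_holds` for
MLF-Galois `TM`-pairs `ι X`, `ι Y` ([AbsTopIII] Prop. 3.2 (iv), «follows immediately from [AbsTopIII],
Proposition 3.2, (iv)», p. 144 l. 36–37). ([IUTchI] Cor 5.3 (ii) p.144) [claim: Mochizuki2012, status: disputed] -/
theorem mapIso_injective_of_readsGalois_of_isTM
    {C : Type u₁} [Category.{v₁} C] {D : Type u₂} [Category.{v₂} D]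
    (ι : C ⥤ GaloisMonoidPair.{0}) [ι.Faithful] (G : C ⥤ D)
    (hG : ∀ {X Y : C} (f g : X ⟶ Y), G.map f = G.map g → (ι.map f).homPi = (ι.map g).homPi)
    {X Y : C} (hX : IsMLFGaloisMonoidPair .TM (ι.obj X)) (hY : IsMLFGaloisMonoidPair .TM (ι.obj Y)) :
    Function.Injective fun α : X ≅ Y => G.mapIso α :=
  mapIso_injective_of_readsGalois ι G hG (pairIsoDeterminedByGalois_holds _ _ hX hY)

/-- The case `C =` the category of pairs itself (`ι = 𝟭`): any functor out of abc-iut-L4-t2's category of pairs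
that reads the Galois component is injective on isomorphisms between MLF-Galois `TM`-pairs.
([IUTchI] Cor 5.3 (ii) p.144) [claim: Mochizuki2012, status: disputed] -/
theorem mapIso_injective_pairs_of_isTM {D : Type u₂} [Category.{v₂} D] (G : GaloisMonoidPair.{0} ⥤ D)
    (hG : ∀ {P Q : GaloisMonoidPair.{0}} (f g : P ⟶ Q), G.map f = G.map g → f.homPi = g.homPi)
    {P Q : GaloisMonoidPair.{0}} (hP : IsMLFGaloisMonoidPair .TM P) (hQ : IsMLFGaloisMonoidPair .TM Q) :
    Function.Injective fun α : P ≅ Q => G.mapIso α :=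
  mapIso_injective_of_readsGalois_of_isTM (𝟭 _) G (fun f g h => hG f g h) hP hQ

/-- The case `C = 𝒞^MLF_TM`, abc-iut-L4-t2's full subcategory `MLFGaloisMonoidPairCat .TM` of MLF-Galois
`TM`-pairs ([AbsTopIII] Def. 3.1 (iii)): EVERY functor out of `𝒞^MLF_TM` that reads the Galois component is
injective on isomorphisms — no hypothesis on the objects.
([IUTchI] Cor 5.3 (ii) p.144) [claim: Mochizuki2012, status: disputed] -/
theorem mapIso_injective_fullSubcategory_TM {D : Type u₂} [Category.{v₂} D]
    (G : MLFGaloisMonoidPairCat.{0} .TM ⥤ D)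
    (hG : ∀ {X Y : MLFGaloisMonoidPairCat.{0} .TM} (f g : X ⟶ Y), G.map f = G.map g → f.hom.homPi = g.hom.homPi)
    (X Y : MLFGaloisMonoidPairCat.{0} .TM) :
    Function.Injective fun α : X ≅ Y => G.mapIso α :=
  mapIso_injective_of_readsGalois_of_isTM (ObjectProperty.ι _) G (fun f g h => hG f g h) X.property Y.property

/-! ### The inner-automorphism form (bases recording outer isomorphisms of `Π`) -/

/-- **Injectivity modulo inner automorphisms.**  If two isomorphisms `e₁, e₂ : (Π ↷ M) ⥲ (Π* ↷ M*)` of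
MLF-Galois `TM`-pairs have Galois components that differ by the inner automorphism of `q ∈ Π*`
(`e₁(g) = q · e₂(g) · q⁻¹`), then their monoid components differ by the action of `q` (`e₁(x) = q • e₂(x)`):
`e₁ = e₂` followed by the inner pair automorphism `GaloisMonoidPair.Iso.conj _ q` of abc-iut-w4-d045
([AbsTopIII] Prop. 3.2 (iv) «contains the subgroup … determined by the inner automorphisms of `Π`»).  This is the
form of the injectivity that survives when the base category `𝒟_v = ℬ^temp(Π_v)⁰` only records OUTER
isomorphisms of `Π_v` ([IUTchI] §0). ([IUTchI] Cor 5.3 (ii) p.144) [claim: Mochizuki2012, status: disputed] -/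
theorem isoM_eq_smul_of_isoPi_eq_conj {P Q : GaloisMonoidPair.{0}}
    (hP : IsMLFGaloisMonoidPair .TM P) (hQ : IsMLFGaloisMonoidPair .TM Q)
    (e₁ e₂ : GaloisMonoidPair.Iso P Q) (q : Q.Pi) (h : ∀ g, e₁.isoPi g = q * e₂.isoPi g * q⁻¹) (x : P.M) :
    e₁.isoM x = q • e₂.isoM x := by
  -- the composite `e₂` followed by the inner automorphism of `q`, as an isomorphism of pairs
  let e₂' : GaloisMonoidPair.Iso P Q :=
    { isoPi := e₂.isoPi.trans (GaloisMonoidPair.Iso.conj Q q).isoPi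
      isoM := e₂.isoM.trans (GaloisMonoidPair.Iso.conj Q q).isoM
      smul_comm := fun g y => by
        change (GaloisMonoidPair.Iso.conj Q q).isoM (e₂.isoM (g • y)) =
          (GaloisMonoidPair.Iso.conj Q q).isoPi (e₂.isoPi g) • (GaloisMonoidPair.Iso.conj Q q).isoM (e₂.isoM y)
        rw [e₂.smul_comm, (GaloisMonoidPair.Iso.conj Q q).smul_comm] }
  have hPi : e₁.isoPi = e₂'.isoPi := ContinuousMulEquiv.ext fun g => by
    change e₁.isoPi g = (GaloisMonoidPair.Iso.conj Q q).isoPi (e₂.isoPi g)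
    rw [GaloisMonoidPair.Iso.conj_isoPi_apply, h]
  have hM := pairIsoDeterminedByGalois_holds P Q hP hQ e₁ e₂' hPi
  have hx := MulEquiv.congr_fun hM x
  rw [hx]
  rfl

/-- Categorical form of `isoM_eq_smul_of_isoPi_eq_conj`: in the category of pairs, two isomorphisms
`a₁, a₂ : P ≅ Q` of MLF-Galois `TM`-pairs whose Galois components differ by `Inn(q)` satisfy
`a₁ = a₂ ≫ conj(q)` (abc-iut-w4-d045's `Iso.conj`, `Iso.toCatIso`).
([IUTchI] Cor 5.3 (ii) p.144) [claim: Mochizuki2012, status: disputed] -/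
theorem catIso_eq_trans_conj_of_homPi_eq_conj {P Q : GaloisMonoidPair.{0}}
    (hP : IsMLFGaloisMonoidPair .TM P) (hQ : IsMLFGaloisMonoidPair .TM Q)
    (a₁ a₂ : P ≅ Q) (q : Q.Pi) (h : ∀ g, a₁.hom.homPi g = q * a₂.hom.homPi g * q⁻¹) :
    a₁ = a₂ ≪≫ (GaloisMonoidPair.Iso.conj Q q).toCatIso := by
  refine catIso_eq_of_homPi_eq_of_isTM hP hQ (MonoidHom.ext fun g => ?_)
  change a₁.hom.homPi g = (GaloisMonoidPair.Iso.conj Q q).toHom.homPi (a₂.hom.homPi g)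
  rw [GaloisMonoidPair.Iso.toHom_homPi_apply, GaloisMonoidPair.Iso.conj_isoPi_apply, h]

end Cor53ii

/-! ### `FKit` currency -/

namespace PMBaseKit

namespace FKit

variable {l : ℕ} {K : PMBaseKit.{u} l} {M : K.MultKit} {FK : K.FKit M}

/-- **Row C53ii/N1 «PAIR-RIGIDITY-TO-FKIT-INJ»: the injectivity half of the hypothesis `h v` of
`isomFtoDBijective_of_model`, for a nonarchimedean slot presented over MLF-Galois `TM`-pairs.**  Let `v` be an
index of abc-iut-L5-t4's `ℱ`-prime-strip kit whose ambient category `FAmb v` is (a category of isomorphs of)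
MLF-Galois `TM`-pairs — presented by a FAITHFUL functor `ι : FAmb v ⥤ GaloisMonoidPair` carrying the model `ℱ_v` to
an MLF-Galois `TM`-pair (`hTM`; «`𝒞_v` as in Examples 3.2, (iii); 3.3, (i)» read through [FrdII] Thm 2.4 /
[AbsTopIII] Def. 3.1 as `(Π_v ↷ 𝒪^⊳_{K̄_v})`) — and whose base functor `toD v` («`ℱ_v ↦ 𝒟_v`», Rmk 5.2.1 (i))
READS THE GALOIS COMPONENT (`hG`).  Then `Isom(ℱ_v, ℱ_v) → Isom(𝒟_v, 𝒟_v)`, `α ↦ (toD v)(α)`, is INJECTIVE on the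
model object — [AbsTopIII] Prop. 3.2 (iv) via `pairIsoDeterminedByGalois_holds` (BY NAME).  The surjectivity
half (L4-t2's schema `GaloisIsoLiftsToTMPairIso`) is not touched.
([IUTchI] Cor 5.3 (ii) p.144) [claim: Mochizuki2012, status: disputed] -/
theorem model_injective_of_readsGalois (v : K.V) (ι : FK.FAmb v ⥤ GaloisMonoidPair.{0}) [ι.Faithful]
    (hG : ∀ {X Y : FK.FAmb v} (f g : X ⟶ Y),
      (FK.toD v).map f = (FK.toD v).map g → (ι.map f).homPi = (ι.map g).homPi)
    (hTM : IsMLFGaloisMonoidPair .TM (ι.obj (FK.fModel v))) :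
    Function.Injective fun α : FK.fModel v ≅ FK.fModel v => (FK.toD v).mapIso α :=
  Cor53ii.mapIso_injective_of_readsGalois_of_isTM ι (FK.toD v) (fun f g h => hG f g h) hTM hTM

/-- The same at ANY two objects of such a slot lying over MLF-Galois `TM`-pairs (not only the model).
([IUTchI] Cor 5.3 (ii) p.144) [claim: Mochizuki2012, status: disputed] -/
theorem mapIso_injective_of_readsGalois (v : K.V) (ι : FK.FAmb v ⥤ GaloisMonoidPair.{0}) [ι.Faithful]
    (hG : ∀ {X Y : FK.FAmb v} (f g : X ⟶ Y),
      (FK.toD v).map f = (FK.toD v).map g → (ι.map f).homPi = (ι.map g).homPi)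
    {X Y : FK.FAmb v} (hX : IsMLFGaloisMonoidPair .TM (ι.obj X)) (hY : IsMLFGaloisMonoidPair .TM (ι.obj Y)) :
    Function.Injective fun φ : X ≅ Y => (FK.toD v).mapIso φ :=
  Cor53ii.mapIso_injective_of_readsGalois_of_isTM ι (FK.toD v) (fun f g h => hG f g h) hX hY

/-- **Injectivity half of abc-iut-L5-t4's `mapIso_bijective_of_model`** (functoriality of `𝔉 ↦ 𝔇`, Rmk 5.2.1
(i)): if `Isom(ℱ_v, ℱ_v) → Isom(𝒟_v, 𝒟_v)` is injective on the MODEL object, it is injective on `Isom(X, Y)` for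
any isomorphs `X ≅ ℱ_v`, `Y ≅ ℱ_v` (conjugation by the chosen isomorphisms).
([IUTchI] Cor 5.3 (ii) p.144) [claim: Mochizuki2012, status: disputed] -/
theorem mapIso_injective_of_model (v : K.V)
    (h : Function.Injective fun α : FK.fModel v ≅ FK.fModel v => (FK.toD v).mapIso α)
    {X Y : FK.FAmb v} (eX : X ≅ FK.fModel v) (eY : Y ≅ FK.fModel v) :
    Function.Injective fun φ : X ≅ Y => (FK.toD v).mapIso φ := by
  intro φ₁ φ₂ hφ
  have key : ∀ φ : X ≅ Y, eX ≪≫ (eX.symm ≪≫ φ ≪≫ eY) ≪≫ eY.symm = φ := fun φ => by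
    ext; simp
  have h' : (FK.toD v).mapIso (eX.symm ≪≫ φ₁ ≪≫ eY) = (FK.toD v).mapIso (eX.symm ≪≫ φ₂ ≪≫ eY) := by
    have hφ' : (FK.toD v).mapIso φ₁ = (FK.toD v).mapIso φ₂ := hφ
    simp only [Functor.mapIso_trans, hφ']
  have h2 := h h'
  rw [← key φ₁, ← key φ₂]
  exact congrArg (fun β => eX ≪≫ β ≪≫ eY.symm) h2

/-- **Injectivity half of Cor 5.3 (ii) from the injectivity of its model cases**: if at every `v ∈ 𝕍` the map
`Isom(ℱ_v, ℱ_v) → Isom(𝒟_v, 𝒟_v)` is injective on the model data, then for all `ℱ`-prime-strips `¹𝔉, ²𝔉` the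
natural map `Isom(¹𝔉, ²𝔉) → Isom(¹𝔇, ²𝔇)` (`FStrip.assocDMap`, Rmk 5.2.1 (i)) is injective — the injectivity half
of abc-iut-L5-t4's `isomFtoDBijective_of_model`, bookable place-type by place-type.
([IUTchI] Cor 5.3 (ii) p.144) [claim: Mochizuki2012, status: disputed] -/
theorem assocDMap_injective_of_model
    (h : ∀ v, Function.Injective fun α : FK.fModel v ≅ FK.fModel v => (FK.toD v).mapIso α)
    (F₁ F₂ : FK.FStrip) :
    Function.Injective (FStrip.assocDMap (FK := FK) (F₁ := F₁) (F₂ := F₂)) := by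
  intro φ₁ φ₂ hφ
  funext v
  exact mapIso_injective_of_model v (h v) (F₁.isModel v).some (F₂.isModel v).some (congrFun hφ v)

/-- **Assembly at one slot**: the injectivity half from this file and a surjectivity half supplied BY NAME
(print: the bijectivity sentence of [AbsTopIII] Prop. 3.2 (iv) for pairs of hyperbolic orbicurve type — L4-t2's
`GaloisIsoLiftsToTMPairIso H` — or [AbsTopIII] Prop. 4.2 (i) at `v ∈ 𝕍^arc`) give the full model case `h v` of
`isomFtoDBijective_of_model` at `v`. ([IUTchI] Cor 5.3 (ii) p.144) [claim: Mochizuki2012, status: disputed] -/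
theorem model_bijective_of_readsGalois_of_surjective (v : K.V) (ι : FK.FAmb v ⥤ GaloisMonoidPair.{0})
    [ι.Faithful]
    (hG : ∀ {X Y : FK.FAmb v} (f g : X ⟶ Y),
      (FK.toD v).map f = (FK.toD v).map g → (ι.map f).homPi = (ι.map g).homPi)
    (hTM : IsMLFGaloisMonoidPair .TM (ι.obj (FK.fModel v)))
    (hsurj : Function.Surjective fun α : FK.fModel v ≅ FK.fModel v => (FK.toD v).mapIso α) :
    Function.Bijective fun α : FK.fModel v ≅ FK.fModel v => (FK.toD v).mapIso α :=
  ⟨model_injective_of_readsGalois v ι (fun f g h => hG f g h) hTM, hsurj⟩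

end FKit

end PMBaseKit

end Literature.IUT.HodgeTheaters
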